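import Summits.AnomalousDissipation.AnomalousDissipation.Theorems.MomentParityQuarticGateOrder3SymShear
import Summits.AnomalousDissipation.AnomalousDissipation.Theorems.MomentParityQuarticGateRealize

/-!
# Order-3 surgery for `MomentParity.QuarticGate` (stmt-AnomalousDissipation-11464), line
# `axis-sectors`, stub `stub_order3SurgerySym` (S5b), helper IV: SYMMETRIC REALIZE

The symmetric version of REALIZE (`exists_measure_of_strictlyKPositive`, infrastructure I3 of the
line `recession-cone`). Data: an orthonormal band basis `b` of the level-`N` Galerkin space with
its shear matrices `M(a)` (`…Order3SymShear`), a finite set `H` of translations containing `0`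
and closed under `+`/`−` (the shear group `H_L`), and a truncated moment sequence `y` on `ℝⁿ`,
`y 0 = 1`, strictly positive in degree `4`. Conclusion (`exists_symmetric_measure`): a
probability measure `μ` on the energy space, carried by level-`N` fields, with finite fourth
moments, whose coordinate polynomial moments of degree `≤ 4` are the `H`-AVERAGES
`|H|⁻¹ Σ_{a ∈ H} L_y(Q ∘ M(a))`, and whose cylindrical statistics are `H`-INVARIANT:
`law((u, gᵢ(·+a))ᵢ) = law((u, gᵢ)ᵢ)` for every family of band tests `g` and every `a ∈ H`.

Proof: Fialkow–Nie (`FialkowNie2010_thm_1_3_holds`) gives `m` on `ℝⁿ` representing `y`; the group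
average `m̄ = |H|⁻¹ Σ_a (M(a))_* m` is `M(a')`-invariant for `a' ∈ H` (reindex `a ↦ a + a'`, using
the representation property `M(a + a') = M(a') M(a)`); push `m̄` forward along the synthesis map
`x ↦ Σ xᵢ bᵢ`; the coordinates of a translated band family at the synthesised field of `x` are the
coordinates of the family at the synthesised field of `M(a) x` (`coords_translate_family`).
-/

-- `Summit.<Summit>.<Problem>` is the tree's mandated summit-side namespace (CONVENTIONS §2); for this
-- single-conjunct summit the two coincide, so the duplicate is deliberate.
set_option linter.dupNamespace false

namespace Summit.AnomalousDissipation.AnomalousDissipation.Theorems.MomentParityQuarticGate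

namespace Order3Sym

open scoped BigOperators InnerProductSpace RealInnerProductSpace ENNReal
open MeasureTheory Filter MvPolynomial Literature.MeasureTheory.Moments
open Literature.Analysis.FunctionSpaces Literature.Analysis.FluidPDE
open Summit.AnomalousDissipation.AnomalousDissipation.Theorems.QuarticGate.Negative

/-! ## Finite sums of measures -/

/-- Push-forward commutes with finite sums of measures (measurable map). [folklore] -/
theorem map_finsetSum {α β ι : Type*} [MeasurableSpace α] [MeasurableSpace β] (s : Finset ι)
    (μ : ι → Measure α) {T : α → β} (hT : Measurable T) :
    Measure.map T (∑ i ∈ s, μ i) = ∑ i ∈ s, Measure.map T (μ i) := by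
  classical
  induction s using Finset.induction_on with
  | empty => simp
  | insert a s ha ih => rw [Finset.sum_insert ha, Finset.sum_insert ha, Measure.map_add _ _ hT, ih]

/-! ## The symmetric realisation -/

variable {N n : ℕ} {b : Fin n → UnitAddTorus (Fin 3) → EuclideanSpace ℝ (Fin 3)}
  {M : UnitAddTorus (Fin 3) → Matrix (Fin n) (Fin n) ℝ}

/-- **SYMMETRIC REALIZE.** See the module docstring (Fialkow–Nie 2010, Thm. 1.3, proved in the tree, pushed forward and group-averaged). [folklore] -/
theorem exists_symmetric_measure (hb : ∀ i, IsBandTest N (b i))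
    (hbo : ∀ i j, ∫ x, ⟪b i x, b j x⟫_ℝ = if i = j then (1 : ℝ) else 0)
    (hbs : ∀ u : Torus.energySpace (Fin 3), IsLevel N u →
      ∀ x, Torus.fourierTruncate N (u.1 : UnitAddTorus (Fin 3) → EuclideanSpace ℝ (Fin 3)) x =
        ∑ i, Torus.pairing u.1 (b i) • b i x)
    (hM : ∀ a k i, M a k i = ∫ y, ⟪b k (y + a), b i y⟫_ℝ)
    (H : Finset (UnitAddTorus (Fin 3))) (hH0 : (0 : UnitAddTorus (Fin 3)) ∈ H)
    (hHadd : ∀ a ∈ H, ∀ a' ∈ H, a + a' ∈ H) (hHsub : ∀ a ∈ H, ∀ a' ∈ H, a - a' ∈ H)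
    (y : (Fin n →₀ ℕ) → ℝ) (hy0 : y 0 = 1)
    (hy : IsStrictlyKPositive (Set.univ : Set (Fin n → ℝ)) 4 y) :
    ∃ μ : Measure (Torus.energySpace (Fin 3)), IsProbabilityMeasure μ ∧ (∀ᵐ u ∂μ, IsLevel N u) ∧
      Integrable (fun u : Torus.energySpace (Fin 3) => ‖u‖ ^ 4) μ ∧
      (∀ Q : MvPolynomial (Fin n) ℝ, Q.totalDegree ≤ 4 →
        Integrable (fun u : Torus.energySpace (Fin 3) =>
          eval (fun i => Torus.pairing u.1 (b i)) Q) μ ∧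
        ∫ u, eval (fun i => Torus.pairing u.1 (b i)) Q ∂μ =
          (H.card : ℝ)⁻¹ * ∑ a ∈ H, rieszFunctional y
            (bind₁ (fun k => ∑ i, C (M a k i) * (X i : MvPolynomial (Fin n) ℝ)) Q)) ∧
      (∀ a ∈ H, ∀ (m : ℕ) (g : Fin m → UnitAddTorus (Fin 3) → EuclideanSpace ℝ (Fin 3)),
        (∀ i, IsBandTest N (g i)) →
        Measure.map (fun u : Torus.energySpace (Fin 3) => fun i =>
            Torus.pairing u.1 (fun x => g i (x + a))) μ =
          Measure.map (fun u : Torus.energySpace (Fin 3) => fun i => Torus.pairing u.1 (g i)) μ) := by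
  classical
  obtain ⟨m, -, hm⟩ := FialkowNie2010_thm_1_3_holds n 4 Set.univ y isClosed_univ
    (isDeterminingSet_univ n 4) hy
  haveI := isProbabilityMeasure_of_moments hm hy0
  -- the shear maps on `ℝⁿ`
  set T : UnitAddTorus (Fin 3) → (Fin n → ℝ) → (Fin n → ℝ) := fun a x => (M a).mulVec x with hT
  have hTc : ∀ a, Continuous (T a) := fun a => by
    rw [hT]
    exact (continuous_const (y := M a)).matrix_mulVec continuous_id
  have hTm : ∀ a, Measurable (T a) := fun a => (hTc a).measurable
  have hTT : ∀ a a', T a' ∘ T a = T (a + a') := fun a a' => funext fun x => by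
    simp only [hT, Function.comp_apply, Matrix.mulVec_mulVec, shearMatrix_add hb hbo hbs hM a a']
  have hTapply : ∀ a x k, T a x k = ∑ i, M a k i * x i := fun a x k => rfl
  -- the averaged coordinate law
  have hcard : ((H.card : ℝ≥0∞)) ≠ 0 ∧ ((H.card : ℝ≥0∞)) ≠ ∞ :=
    ⟨by exact_mod_cast (Finset.card_pos.mpr ⟨0, hH0⟩).ne', ENNReal.natCast_ne_top _⟩
  have hcardR : (H.card : ℝ) ≠ 0 := by exact_mod_cast (Finset.card_pos.mpr ⟨0, hH0⟩).ne'
  set mbar : Measure (Fin n → ℝ) := ((H.card : ℝ≥0∞))⁻¹ • ∑ a ∈ H, Measure.map (T a) m with hmbar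
  haveI hprob : ∀ a, IsProbabilityMeasure (Measure.map (T a) m) := fun a =>
    Measure.isProbabilityMeasure_map (hTm a).aemeasurable
  haveI : IsProbabilityMeasure mbar := by
    refine ⟨?_⟩
    rw [hmbar, Measure.smul_apply, Measure.finsetSum_apply, smul_eq_mul]
    simp only [measure_univ, Finset.sum_const, nsmul_eq_mul, mul_one]
    exact ENNReal.inv_mul_cancel hcard.1 hcard.2
  -- integrals against `mbar`
  have hint_mbar : ∀ F : (Fin n → ℝ) → ℝ, Continuous F → (∀ a ∈ H, Integrable (F ∘ T a) m) →
      Integrable F mbar ∧ ∫ x, F x ∂mbar = (H.card : ℝ)⁻¹ * ∑ a ∈ H, ∫ x, F (T a x) ∂m := by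
    intro F hF hFi
    have h1 : ∀ a ∈ H, Integrable F (Measure.map (T a) m) := fun a ha =>
      (integrable_map_measure hF.aestronglyMeasurable (hTm a).aemeasurable).2 (hFi a ha)
    refine ⟨(integrable_finsetSum_measure.2 h1).smul_measure (ENNReal.inv_ne_top.2 hcard.1), ?_⟩
    rw [hmbar, integral_smul_measure, integral_finsetSum_measure h1]
    simp only [ENNReal.toReal_inv, ENNReal.toReal_natCast, smul_eq_mul]
    congr 1
    exact Finset.sum_congr rfl fun a _ => integral_map (hTm a).aemeasurable hF.aestronglyMeasurable
  -- polynomial moments of the pushed-forward laws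
  have hmomT : ∀ Q : MvPolynomial (Fin n) ℝ, Q.totalDegree ≤ 4 → ∀ a,
      Integrable ((fun x => eval x Q) ∘ T a) m ∧ ∫ x, eval (T a x) Q ∂m =
        rieszFunctional y (bind₁ (fun k => ∑ i, C (M a k i) * (X i : MvPolynomial (Fin n) ℝ)) Q) := by
    intro Q hQ a
    obtain ⟨hi, he⟩ := integrable_eval_of_moments hm _
      ((totalDegree_bind₁_linear_le (fun k i => M a k i) Q).trans hQ)
    have hfun : ((fun x => eval x Q) ∘ T a) =
        fun x => eval x (bind₁ (fun k => ∑ i, C (M a k i) * (X i : MvPolynomial (Fin n) ℝ)) Q) :=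
      funext fun x => by
        rw [Function.comp_apply, eval_bind₁_linear]
        rfl
    refine ⟨by rw [hfun]; exact hi, ?_⟩
    rw [← he]
    exact congrArg (fun F : (Fin n → ℝ) → ℝ => ∫ x, F x ∂m) hfun
  have hmomQ : ∀ Q : MvPolynomial (Fin n) ℝ, Q.totalDegree ≤ 4 →
      Integrable (fun x => eval x Q) mbar ∧ ∫ x, eval x Q ∂mbar = (H.card : ℝ)⁻¹ * ∑ a ∈ H,
        rieszFunctional y (bind₁ (fun k => ∑ i, C (M a k i) * (X i : MvPolynomial (Fin n) ℝ)) Q) := by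
    intro Q hQ
    obtain ⟨hi, he⟩ := hint_mbar (fun x => eval x Q) (continuous_eval Q) fun a _ => (hmomT Q hQ a).1
    refine ⟨hi, ?_⟩
    rw [he]
    congr 1
    exact Finset.sum_congr rfl fun a _ => (hmomT Q hQ a).2
  -- invariance of `mbar` under the shear maps of `H`
  have hinv : ∀ a' ∈ H, Measure.map (T a') mbar = mbar := by
    intro a' ha'
    rw [hmbar, Measure.map_smul, map_finsetSum H _ (hTm a')]
    congr 1
    simp_rw [Measure.map_map (hTm a') (hTm _), hTT]
    exact Finset.sum_nbij' (fun a => a + a') (fun a => a - a') (fun a ha => hHadd a ha a' ha')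
      (fun a ha => hHsub a ha a' ha') (fun a _ => add_sub_cancel_right a a')
      (fun a _ => sub_add_cancel a a') fun a _ => rfl
  -- the synthesis map
  obtain ⟨B, hB⟩ := exists_synthesis hb hbo
  obtain ⟨L, hL⟩ : ∃ L : (Fin n → ℝ) →ₗ[ℝ] Torus.energySpace (Fin 3), ∀ x, L x = ∑ i, x i • B i :=
    ⟨∑ i, (LinearMap.proj i).smulRight (B i), fun x => by simp⟩
  have hLc : Continuous L := L.continuous_of_finiteDimensional
  have hLm : Measurable L := hLc.measurable
  have hlev : ∀ x, IsLevel N (L x) := fun x => by rw [hL x]; exact (hB x).1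
  have hcoord : ∀ x i, Torus.pairing (L x).1 (b i) = x i := fun x i => by
    rw [hL x]; exact congr_fun (hB x).2.1 i
  have hnorm : ∀ x, ‖L x‖ ^ 2 = ∑ i, x i ^ 2 := fun x => by rw [hL x]; exact (hB x).2.2.1
  refine ⟨mbar.map L, Measure.isProbabilityMeasure_map hLm.aemeasurable, ?_, ?_, fun Q hQ => ?_, ?_⟩
  · -- carried by level-`N` fields
    have hr : MeasurableSet (Set.range L) := by
      rw [← LinearMap.coe_range]
      exact (Submodule.closed_of_finiteDimensional _).measurableSet
    filter_upwards [ae_map_mem_range L hr mbar] with u hu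
    obtain ⟨x, rfl⟩ := hu
    exact hlev x
  · -- fourth moments
    have hQeval : ∀ x : Fin n → ℝ,
        eval x ((∑ i : Fin n, X i ^ 2) ^ 2 : MvPolynomial (Fin n) ℝ) = (∑ i, x i ^ 2) ^ 2 := by
      intro x
      simp [map_sum, map_pow]
    have h4c : Continuous fun u : Torus.energySpace (Fin 3) => ‖u‖ ^ 4 := continuous_norm.pow 4
    rw [integrable_map_measure h4c.aestronglyMeasurable hLm.aemeasurable]
    refine (hmomQ _ (totalDegree_sum_X_sq_sq_le n)).1.congr (ae_of_all _ fun x => ?_)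
    simp only [Function.comp_apply]
    rw [hQeval, ← hnorm, ← pow_mul]
  · -- coordinate polynomials of degree ≤ 4
    have hcont : Continuous fun u : Torus.energySpace (Fin 3) =>
        eval (fun i => Torus.pairing u.1 (b i)) Q :=
      (continuous_eval Q).comp (continuous_coords hb)
    have hcomp : (fun u : Torus.energySpace (Fin 3) =>
        eval (fun i => Torus.pairing u.1 (b i)) Q) ∘ L = fun x => eval x Q := by
      funext x
      simp only [Function.comp_apply]
      rw [show (fun i => Torus.pairing (L x).1 (b i)) = x from funext (hcoord x)]
    obtain ⟨hi, he⟩ := hmomQ Q hQ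
    refine ⟨(integrable_map_measure hcont.aestronglyMeasurable hLm.aemeasurable).2
      (by rw [hcomp]; exact hi), ?_⟩
    rw [integral_map hLm.aemeasurable hcont.aestronglyMeasurable]
    simp_rw [show ∀ x, (fun i => Torus.pairing (L x).1 (b i)) = x from fun x => funext (hcoord x)]
    exact he
  · -- `H`-invariance of the cylindrical statistics
    intro a ha m' g hg
    have hga : ∀ i, IsBandTest N (fun x => g i (x + a)) := fun i => isBandTest_translate (hg i) a
    have hΦ : Measurable fun u : Torus.energySpace (Fin 3) => fun i => Torus.pairing u.1 (g i) :=
      (continuous_coords hg).measurable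
    have hΦa : Measurable fun u : Torus.energySpace (Fin 3) => fun i =>
        Torus.pairing u.1 (fun x => g i (x + a)) := (continuous_coords hga).measurable
    have hfun : (fun u : Torus.energySpace (Fin 3) => fun i =>
        Torus.pairing u.1 (fun x => g i (x + a))) ∘ L =
        ((fun u : Torus.energySpace (Fin 3) => fun i => Torus.pairing u.1 (g i)) ∘ L) ∘ T a := by
      funext x
      simp only [Function.comp_apply]
      exact coords_translate_family hb hbs hM hg a (L x) (L (T a x)) x (hcoord x)
        fun k => by rw [hcoord (T a x) k, hTapply]
    rw [Measure.map_map hΦa hLm, hfun, ← Measure.map_map (hΦ.comp hLm) (hTm a), hinv a ha,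
      Measure.map_map hΦ hLm]

end Order3Sym

open scoped InnerProductSpace RealInnerProductSpace in
open MeasureTheory MvPolynomial Literature.MeasureTheory.Moments Literature.Analysis.FunctionSpaces Literature.Analysis.FluidPDE Summit.AnomalousDissipation.AnomalousDissipation.Theorems.QuarticGate.Negative in
/-- **Registered sub-goal of stub S5b (summary of this file): SYMMETRIC REALIZE (Fialkow–Nie 2010, Thm. 1.3, group-averaged).** [folklore] -/
theorem order3Sym_exists_symmetric_measure : ∀ {N n : ℕ} {b : Fin n → UnitAddTorus (Fin 3) → EuclideanSpace ℝ (Fin 3)} {M : UnitAddTorus (Fin 3) → Matrix (Fin n) (Fin n) ℝ}, (∀ i, IsBandTest N (b i)) → (∀ i j, ∫ x, ⟪b i x, b j x⟫_ℝ = if i = j then (1 : ℝ) else 0) → (∀ u : Torus.energySpace (Fin 3), IsLevel N u → ∀ x, Torus.fourierTruncate N (u.1 : UnitAddTorus (Fin 3) → EuclideanSpace ℝ (Fin 3)) x = ∑ i, Torus.pairing u.1 (b i) • b i x) → (∀ a k i, M a k i = ∫ y, ⟪b k (y + a), b i y⟫_ℝ) → ∀ (H : Finset (UnitAddTorus (Fin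 3))), (0 : UnitAddTorus (Fin 3)) ∈ H → (∀ a ∈ H, ∀ a' ∈ H, a + a' ∈ H) → (∀ a ∈ H, ∀ a' ∈ H, a - a' ∈ H) → ∀ (y : (Fin n →₀ ℕ) → ℝ), y 0 = 1 → Literature.MeasureTheory.Moments.IsStrictlyKPositive (Set.univ : Set (Fin n → ℝ)) 4 y → ∃ μ : Measure (Torus.energySpace (Fin 3)), IsProbabilityMeasure μ ∧ (∀ᵐ u ∂μ, IsLevel N u) ∧ Integrable (fun u : Torus.energySpace (Fin 3) => ‖u‖ ^ 4) μ ∧ (∀ Q : MvPolynomial (Fin n) ℝ, Q.totalDegree ≤ 4 → Integrable (fun u : Torus.energySpace (Fin 3) => MvPolynomial.eval (fun i => Torus.pairing u.1 (b i)) Q) μ ∧ ∫ u, MvPolynomial.eval (fun i => Torus.pairing u.1 (b i)) Q ∂μ = (H.card : ℝ)⁻¹ * ∑ a ∈ H, Literature.MeasureTheory.Moments.rieszFunctional y (MvPolynomial.bind₁ (fun k => ∑ i, MvPolynomial.C (M a k i) * (MvPolynomial.X i : MvPolynomial (Fin n) ℝ)) Q)) ∧ (∀ a ∈ H, ∀ (m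 : ℕ) (g : Fin m → UnitAddTorus (Fin 3) → EuclideanSpace ℝ (Fin 3)), (∀ i, IsBandTest N (g i)) → Measure.map (fun u : Torus.energySpace (Fin 3) => fun i => Torus.pairing u.1 (fun x => g i (x + a))) μ = Measure.map (fun u : Torus.energySpace (Fin 3) => fun i => Torus.pairing u.1 (g i)) μ) :=
  fun hb hbo hbs hM H hH0 hHadd hHsub y hy0 hy => Order3Sym.exists_symmetric_measure hb hbo hbs hM H hH0 hHadd hHsub y hy0 hy

end Summit.AnomalousDissipation.AnomalousDissipation.Theorems.MomentParityQuarticGate
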